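import Literature.NumberTheory.EllipticCurves.GoodReductionUnramifiedProofs
import Literature.NumberTheory.EllipticCurves.GaloisH1DevissageCountProofs
import Literature.NumberTheory.EllipticCurves.TwoTorsionCardProofs
import Mathlib.Data.ZMod.QuotientGroup
import HarnessLib

/-!
# `#Sel^{(2)}(E/K) ≤ (#K(S, 2))²` for an elliptic curve with a rational `2`-torsion point
# (`≤ 4^{#S+1}` over `ℚ`)

For an elliptic curve `E` over a number field `K` with a `K`-rational point `P` of order `2`, and
a finite set `S` of finite places containing the places of bad reduction and the places above `2`,
the `2`-Selmer group (the tree's cohomological `WeierstrassCurve.selmerGroup W 2 ⊆ H¹(K, E[2])`)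
satisfies

  `#Sel^{(2)}(E/K) ≤ (#K(S, 2))²`  (`WeierstrassCurve.natCard_selmerGroup_two_le_sq`),

and over `ℚ`, `#Sel^{(2)}(E/ℚ) ≤ 4^{#S+1}` (`WeierstrassCurve.natCard_selmerGroup_two_le_four_pow`).
This is the classical bound of descent via two-isogeny (Silverman, *The Arithmetic of Elliptic
Curves*, 2nd ed., X.§4, Prop. 4.9 with Ex. 4.8 and Lemma 4.3; Cor. X.4.4 for the reduction to
classes unramified outside `S`), obtained here cohomologically: by Cor. X.4.4
(`selmerGroup_le_h1Unramified_holds`) Selmer classes are unramified outside `S`; the inertia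
groups outside `S` act trivially on `E[2]` (Prop. VII.4.1(a), the tree's
`smul_geomTorsion_eq_of_mem_inertia`, file `GoodReductionUnramifiedProofs`); `#E[2] ≤ 4`
(`natCard_torsionBy_two_le`) and `P` is fixed by `G_K`, so `G_K` acts trivially on `⟨P⟩` and on
`E[2]/⟨P⟩` (`sub_mem_pair_of_natCard_le_four`); and the dévissage count
`ncard_le_sq_of_devissage` (`GaloisH1DevissageCountProofs`) bounds the unramified classes by
`#X_S(E[2]/⟨P⟩) · #X_S(⟨P⟩) ≤ (#K(S,2))²`, `X_S(A) ↪ K(S, 2)` being the quadratic characters of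
`G_K` unramified outside `S` (Kummer theory, Prop. VIII.1.6 counted).

It is the input "`#Sel₂(E_{A,B}) ≪ 4^{ω(Δ)}`" of the tree's discharge of Bhargava–Shankar's
Prop. 5.8 (`bhargavaShankar_sum_card_selmerTwo_twoTorsion_le`, file
`BhargavaShankarTwoTorsionProofs`).

## References

* J. H. Silverman, *The Arithmetic of Elliptic Curves*, 2nd ed., GTM 106 (2009): VII.4.1,
  X.§4 (Thm. 4.2, Lemma 4.3, Cor. 4.4, Ex. 4.8, Prop. 4.9).
  [cite: SilvermanAEC2009, Prop. X.4.9 (with Cor. X.4.4)]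

## Tree reuse

`selmerGroup_le_h1Unramified_holds`, `finite_torsionPoints_holds` (`SelmerFiniteProofs`,
`GaloisActionProofs`); `smul_geomTorsion_eq_of_mem_inertia` (`GoodReductionUnramifiedProofs`,
Prop. VII.4.1(a) for the global inertia groups); `natCard_torsionBy_two_le`,
`sub_mem_pair_of_natCard_le_four` (`TwoTorsionCardProofs`); `ncard_le_sq_of_devissage`,
`Rat.natCard_selmerGroup_two_le` (`GaloisH1DevissageCountProofs`, `KummerCharacterCountProofs`).

## Design

No definitions; dot-notation extensions of `WeierstrassCurve` as in `SelmerInertia`. The rational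
`2`-torsion point is taken geometrically: `P : geomPoints W`, `P ≠ 0`, `P ∈ E[2]`, fixed by `G_K`
(for a `K`-rational point `(r, 0)` of `y² = x³ + Ax + B` these are immediate; file
`BhargavaShankarTwoTorsionProofs`). One universe `u`, `noncomputable section`,
`open scoped Classical`.
-/

noncomputable section

open scoped Classical NumberField

open NumberField IsDedekindDomain Field Literature.NumberTheory.EllipticCurves
  Literature.NumberTheory.GaloisRepresentations

universe u

namespace WeierstrassCurve

variable {K : Type u} [Field K] [NumberField K] (W : WeierstrassCurve K)

/-! ## Inertia outside `S` acts trivially on `E[n]` -/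

/-- `E[n]` is unramified outside `S ⊇ {bad places} ∪ {v ∣ n}`: every inertia group `I_𝔓`,
`𝔓 ∣ v ∉ S`, acts trivially on the `G_K`-module `E[n] = geomTorsion W n` (Silverman, *AEC*,
Prop. VII.4.1(a); the tree's `smul_geomTorsion_eq_of_mem_inertia`, in the shape of the hypothesis
`hI` of `ncard_le_sq_of_devissage`). [cite: SilvermanAEC2009, Prop. VII.4.1(a)] -/
theorem smul_geomTorsion_eq_of_mem_inertia_of_subset [W.IsElliptic] {n : ℤ}
    {S : Set (HeightOneSpectrum (𝓞 K))} (hbad : W.badPlaces (𝓞 K) ⊆ S)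
    (hdiv : ∀ v : HeightOneSpectrum (𝓞 K), (n : 𝓞 K) ∈ v.asIdeal → v ∈ S) :
    ∀ v ∉ S, ∀ 𝔓 ∈ v.primesAbove, ∀ τ ∈ 𝔓.inertia (absoluteGaloisGroup K),
      ∀ m : geomTorsion W n, τ • m = m := by
  intro v hv 𝔓 h𝔓 τ hτ m
  have hgood : W.HasGoodReductionAt v := by
    by_contra h
    exact hv (hbad h)
  exact W.smul_geomTorsion_eq_of_mem_inertia hgood (fun h ↦ hv (hdiv v h)) h𝔓 hτ m

/-! ## The bound -/

/-- **`#Sel^{(2)}(E/K) ≤ (#K(S, 2))²` for a curve with a rational `2`-torsion point.** Let `E/K`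
be an elliptic curve over a number field with a point `P ∈ E(K̄)` of order `2` fixed by `G_K`
(a `K`-rational `2`-torsion point), and `S` a finite set of finite places containing the places
of bad reduction and those above `2`. Then `#Sel^{(2)}(E/K) ≤ (#K(S, 2))²`. Silverman, *AEC*,
X.§4: Cor. 4.4 (Selmer classes are unramified outside `S`), Lemma 4.3, and Prop. 4.9 / Ex. 4.8
(descent via two-isogeny, `S^{(φ)} ↪ K(S, 2)`), here via the dévissage
`0 → ⟨P⟩ → E[2] → E[2]/⟨P⟩ → 0` of `G_K`-modules with trivial outer actions
(`ncard_le_sq_of_devissage`). [cite: SilvermanAEC2009, Prop. X.4.9 (with Cor. X.4.4)] -/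
theorem natCard_selmerGroup_two_le_sq [W.IsElliptic] (P : geomPoints W) (hP0 : P ≠ 0)
    (hP2 : P ∈ geomTorsion W 2) (hPfix : ∀ σ : absoluteGaloisGroup K, σ • P = P)
    {S : Set (HeightOneSpectrum (𝓞 K))} (hS : S.Finite) (hbad : W.badPlaces (𝓞 K) ⊆ S)
    (h2 : ∀ v : HeightOneSpectrum (𝓞 K), ((2 : ℤ) : 𝓞 K) ∈ v.asIdeal → v ∈ S) :
    Nat.card (W.selmerGroup 2) ≤
      Nat.card (IsDedekindDomain.selmerGroup (R := 𝓞 K) (K := K) (S := S) (n := 2)) ^ 2 := by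
  -- the module `M = E[2]`, finite of order `≤ 4`
  haveI hfinM : Finite (geomTorsion W 2) := W.finite_torsionPoints_holds (AlgebraicClosure K) two_ne_zero
  have h4 : Nat.card (geomTorsion W 2) ≤ 4 := by
    have h := (W.baseChange (AlgebraicClosure K)).natCard_torsionBy_two_le
      (two_ne_zero : (2 : AlgebraicClosure K) ≠ 0)
    exact h
  have hdouble : ∀ m : geomTorsion W 2, m + m = 0 := by
    intro m
    apply Subtype.ext
    have hm : (2 : ℤ) • (m : geomPoints W) = 0 := (Submodule.mem_torsionBy_iff (2 : ℤ) _).mp m.2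
    rw [AddSubgroup.coe_add, AddSubgroup.coe_zero, ← two_zsmul, hm]
  -- the fixed point and the dévissage `π : M → M/⟨P⟩`
  set p₀ : geomTorsion W 2 := ⟨P, hP2⟩ with hp₀
  have hp₀0 : p₀ ≠ 0 := fun h ↦ hP0 (congrArg Subtype.val h)
  have hp₀fix : ∀ σ : absoluteGaloisGroup K, σ • p₀ = p₀ := fun σ ↦ Subtype.ext (by
    rw [Literature.NumberTheory.EllipticCurves.AddSubgroup.torsionBy.coe_smul]; exact hPfix σ)
  set N : AddSubgroup (geomTorsion W 2) := AddSubgroup.zmultiples p₀ with hN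
  set π : geomTorsion W 2 →+ geomTorsion W 2 ⧸ N := QuotientAddGroup.mk' N with hπ
  have hkerπ : π.ker = N := QuotientAddGroup.ker_mk' N
  have hcardN : Nat.card N = 2 := by
    rw [hN, Nat.card_zmultiples]
    exact addOrderOf_eq_prime (by rw [two_nsmul]; exact hdouble p₀) hp₀0
  have hcardQ : Nat.card (geomTorsion W 2 ⧸ N) ≤ 2 := by
    have h := AddSubgroup.card_eq_card_quotient_mul_card_addSubgroup N
    rw [hcardN] at h
    omega
  haveI : Finite π.ker := by rw [hkerπ]; infer_instance
  have hcardker : Nat.card π.ker ≤ 2 := by rw [hkerπ, hcardN]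
  -- `G_K` acts trivially on `M/⟨P⟩` …
  have hdev : ∀ (σ : absoluteGaloisGroup K) (m : geomTorsion W 2), π (σ • m) = π m := by
    intro σ m
    have hmem : σ • m - m ∈ N := by
      rcases sub_mem_pair_of_natCard_le_four h4 hdouble hp₀0
        (DistribSMul.toAddMonoidHom (geomTorsion W 2) σ) (MulAction.injective σ)
        (hp₀fix σ) m with h | h
      · rw [DistribSMul.toAddMonoidHom_apply] at h
        rw [h]; exact N.zero_mem
      · rw [DistribSMul.toAddMonoidHom_apply] at h
        rw [h]; exact AddSubgroup.mem_zmultiples p₀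
    rw [hπ, QuotientAddGroup.mk'_apply, QuotientAddGroup.mk'_apply, eq_comm, QuotientAddGroup.eq]
    rwa [neg_add_eq_sub]
  -- … and on `⟨P⟩`
  have hfix : ∀ m : geomTorsion W 2, π m = 0 → ∀ σ : absoluteGaloisGroup K, σ • m = m := by
    intro m hm σ
    have hmN : m ∈ N := by rw [← hkerπ]; exact hm
    obtain ⟨k, rfl⟩ := AddSubgroup.mem_zmultiples_iff.mp hmN
    have hk := map_zsmul (DistribSMul.toAddMonoidHom (geomTorsion W 2) σ) k p₀
    simp only [DistribSMul.toAddMonoidHom_apply] at hk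
    rw [hk, hp₀fix σ]
  -- inertia outside `S` acts trivially on `E[2]` (Prop. VII.4.1(a))
  have hI := W.smul_geomTorsion_eq_of_mem_inertia_of_subset (n := 2) hbad h2
  -- Selmer classes are unramified outside `S` (Cor. X.4.4)
  have hC : ((W.selmerGroup 2 : AddSubgroup (W.galH1Torsion 2)) : Set (W.galH1Torsion 2)) ⊆
      h1Unramified (geomTorsion W 2) S := W.selmerGroup_le_h1Unramified_holds two_ne_zero hbad h2
  letI : TopologicalSpace (geomTorsion W 2 ⧸ N) := ⊥
  haveI : DiscreteTopology (geomTorsion W 2 ⧸ N) := ⟨rfl⟩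
  have key := ncard_le_sq_of_devissage (M := geomTorsion W 2) hS hcardQ π hdev hfix hcardker hI
    _ hC
  rwa [← SetLike.coe_sort_coe, Nat.card_coe_set_eq]

/-- **`#Sel^{(2)}(E/ℚ) ≤ 4^{#S+1}`** for an elliptic curve over `ℚ` with a rational `2`-torsion
point, `S` a finite set of primes containing the bad primes and `2` (Silverman, *AEC*, X.4.9 with
Ex. X.4.8: `#S^{(φ)}(E/ℚ), #S^{(φ̂)}(E'/ℚ) ≤ #ℚ(S, 2) = 2^{#S+1}` counting the sign).
[cite: SilvermanAEC2009, Prop. X.4.9 (with Cor. X.4.4)] -/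
theorem natCard_selmerGroup_two_le_four_pow (W : WeierstrassCurve ℚ) [W.IsElliptic]
    (P : geomPoints W) (hP0 : P ≠ 0) (hP2 : P ∈ geomTorsion W 2)
    (hPfix : ∀ σ : absoluteGaloisGroup ℚ, σ • P = P)
    {S : Set (HeightOneSpectrum (𝓞 ℚ))} (hS : S.Finite) (hbad : W.badPlaces (𝓞 ℚ) ⊆ S)
    (h2 : ∀ v : HeightOneSpectrum (𝓞 ℚ), ((2 : ℤ) : 𝓞 ℚ) ∈ v.asIdeal → v ∈ S) :
    Nat.card (W.selmerGroup 2) ≤ 4 ^ (Nat.card S + 1) := by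
  calc Nat.card (W.selmerGroup 2)
      ≤ Nat.card (IsDedekindDomain.selmerGroup (R := 𝓞 ℚ) (K := ℚ) (S := S) (n := 2)) ^ 2 :=
        W.natCard_selmerGroup_two_le_sq P hP0 hP2 hPfix hS hbad h2
    _ ≤ (2 ^ (Nat.card S + 1)) ^ 2 :=
        Nat.pow_le_pow_left (_root_.Rat.natCard_selmerGroup_two_le hS) 2
    _ = 4 ^ (Nat.card S + 1) := by rw [← pow_mul, mul_comm, pow_mul]; norm_num

end WeierstrassCurve

end
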